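import Summits.AnomalousDissipation.AnomalousDissipation.Theses.MarginalStabilityChain
import Summits.AnomalousDissipation.AnomalousDissipation.Theorems.MarginalStabilityChainChainRealisationStubAxialMomentum
import Summits.AnomalousDissipation.AnomalousDissipation.Theorems.MarginalStabilityChainChainRealisationStubPinnedFlux
import Summits.AnomalousDissipation.AnomalousDissipation.Theorems.MarginalStabilityChainChainRealisationStubEddyEnergy
import Summits.AnomalousDissipation.AnomalousDissipation.Theorems.MarginalStabilityChainChainRealisationStubAnnulusLogEnergy
import Summits.AnomalousDissipation.AnomalousDissipation.Theorems.MarginalStabilityChainChainRealisationStubLoudOfContrast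
import Summits.AnomalousDissipation.AnomalousDissipation.Theorems.MarginalStabilityChainChainRealisationStubPhaseMeans
import Summits.AnomalousDissipation.AnomalousDissipation.Theorems.MarginalStabilityChainChainRealisationStubInvariantMeasure
import Summits.AnomalousDissipation.AnomalousDissipation.Theorems.MarginalStabilityChainChainRealisationStubGenericLoudPoint
import Summits.AnomalousDissipation.AnomalousDissipation.Theorems.MarginalStabilityChainChainRealisationStubEternalOrbit
import Summits.AnomalousDissipation.AnomalousDissipation.Theorems.MarginalStabilityChainChainRealisationStubLoudOfContrastZM
import Summits.AnomalousDissipation.AnomalousDissipation.Theorems.MarginalStabilityChainChainRealisationStubTimeAvgLaplacianBound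
import Summits.AnomalousDissipation.AnomalousDissipation.Theorems.MarginalStabilityChainChainRealisationStubUniformGronwall
import Summits.AnomalousDissipation.AnomalousDissipation.Theorems.MarginalStabilityChainChainRealisationStubH2NonlinearEstimate
import Summits.AnomalousDissipation.AnomalousDissipation.Theorems.MarginalStabilityChainChainRealisationStubLaplacianSupBound
import Summits.AnomalousDissipation.AnomalousDissipation.Theorems.MarginalStabilityChainChainRealisationEternalisation
import Summits.AnomalousDissipation.AnomalousDissipation.Theorems.BaireTransferDenseLoudDesignerForcesErgodicLine
import Literature.Analysis.FunctionSpaces.TorusPlanarLift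
import Literature.Analysis.FunctionSpaces.TorusLinearisedFormTruncation
import Literature.Analysis.FunctionSpaces.TorusAxisAverage
import Summits.AnomalousDissipation.AnomalousDissipation.Theorems.MarginalStabilityChainChainRealisationStubConvectWordEstimate
import Summits.AnomalousDissipation.AnomalousDissipation.Theorems.MarginalStabilityChainChainRealisationStubSobolevBootstrap
import Summits.AnomalousDissipation.AnomalousDissipation.Theorems.MarginalStabilityChainChainRealisationStubAscoliSmooth
import Summits.AnomalousDissipation.AnomalousDissipation.Theorems.MarginalStabilityChainChainRealisationStubLiftBounds
import Summits.AnomalousDissipation.AnomalousDissipation.Theorems.MarginalStabilityChainChainRealisationStubCompactLimitsOfShifts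
import Summits.AnomalousDissipation.AnomalousDissipation.Theorems.MarginalStabilityChainChainRealisationStubPhaseOfCompactLimits
import Literature.Analysis.FluidPDE.TorusWordEnergy
import Literature.Analysis.FluidPDE.TorusWordSpaceTime
import Literature.Analysis.Calculus.ContDiffUniformLimit
import HarnessLib.Audit

/-!
# Line `SketchIdeator2` (card `separatrix-flux-pinning`) — skeleton for crux `MarginalStabilityChain.ChainRealisation`
(item stmt-AnomalousDissipation-14249, route route-AnomalousDissipation-MarginalStabilityChain; line leads
prover-line-stmt-AnomalousDissipation-14249-0 (v1–v5), -1 (v6–v7: forward phase B1–B6 LANDED, assembly p105517) and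
-c1-0 (v6′: P1 `stub_pureBalance` p97715, P2 `stub_windowP3` p99625, P3 `stub_sobolevLadder` p104126 + tools p102752 LANDED))

CANONICAL FINAL FORM (v9 = lead -1's v7, adopted by lead c1-0 on 2026-08-16 after the two concurrent leads converged):
rc 0, EXACTLY ONE `sorry` = the conjecture-grade residual `stub_contrastFamily : ContrastFamily` (the zeroth-law
content of the crux for a 2½-D-forced arena, Bruè–De Lellis 2023 Q2.2 — energy ceiling load-bearing, symmetry must
break: `Cruxes/ChainRealisation/Disproof.lean` §3–§4, landed `Theorems/ChainRealisation/Negative/Residual*.lean`).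
Everything else of the line — the card identities, the budget step, the `H²` absorbing bound, the FORWARD PHASE at
fixed `ν` (`…Theorems.MarginalStabilityChainChainRealisationForwardPhase.forwardPhaseH2_holds`), eternalisation
(`eternalisationZM_holds`) and `chainRealisation_of_contrastFamily` — is a theorem of the tree.  Both leads end with
`promote-stub: stub_contrastFamily`.

Crux (fixed): `ChainRealisation : StrainedLayerLaw → BurgersLayerKH → StretchedVortexRows → ChainThesis`.
The three antecedents are ℝ²/ℝ-typed unit-cell statements with no transfer lemma to `T³` (crux-attack note
RESTATES-TARGET, confirmed): every proof factors through the consequent (`chainRealisation_of_chainThesis`, §0), so a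
line for this crux is a line producing `ChainThesis` — ONE steady smooth solenoidal mean-zero force on `T³`, `ν_j → 0`,
complete classical trajectories with bounded limsup-mean energy and limsup-mean dissipation `≥ ε > 0`.

Idea (card `Ideas/separatrix-flux-pinning.md`, ideator 2, round 1; this file OWNS the ideate sketch `SketchIdeator2.lean`
as a line).  Arena force `f = twoHalf g (μ • h)` on `T³` (planar cellular `g : T² → ℝ²`, cell-signed axial pattern
`h : T² → ℝ`, tree `Torus.twoHalf`).  The `x₂`-averaged axial momentum is a PRESSURE-FREE conserved scalar
(`AxialMomentumTestIdentity`, §1), so across every closed streamline of the mean planar flow the eddy flux of axial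
momentum is pinned by the enclosed forcing (`PinnedSeparatrixFlux`, Rhines–Young with a source) and eddies must carry
`O(μ)` energy ON every such streamline (`EddyEnergyOnStreamline`).  These identities pin the AMPLITUDE on the separatrix
layers for free; what is left of the crux's level-0 content is ONE signed mean-field statement, the axial-contrast floor
`⟨(h, u₂)⟩ ≥ a₀ > 0` uniformly in `ν` at bounded energy (`stub_contrastFamily`, the residual, conjecture-grade: it is the
zeroth-law content of the crux in Eulerian mean-field form).  Given it, energy EQUALITY of classical solutions turns the
contrast floor into a dissipation floor (`stub_loudOfContrast`: mean dissipation = mean injection `= ⟨(g,u_h)⟩ + μ⟨(h,u₂)⟩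
≥ μ a₀`), i.e. a forward-regular loud bounded family for ONE force, and the single-viscosity eternalisation lemma of crux
3005's passed line `generic-point-eternalisation` (`EternalisationAt`, re-declared verbatim, `stub_eternalisation`) gives
`ChainThesis`, hence the crux BY NAME (`ChainRealisation_of`, §4).

Stubs (7, registered; sizes):
* `stub_axialMomentumTestIdentity : AxialMomentumTestIdentity` — M, provable now (torus calculus: momentum eq. component 2,
  `∂₂(ψ ∘ planarProj) = 0` kills the pressure, IBP of the convective/viscous terms, differentiation under `∫`).
* `stub_pinnedSeparatrixFlux : PinnedSeparatrixFlux` — S–M, provable now (chain rule `∇(G∘Ψ) = G'(Ψ)∇Ψ`, `⟪∇⊥Ψ,∇Ψ⟫ = 0`).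
* `stub_eddyEnergyOnStreamline : PinnedSeparatrixFlux → EddyEnergyOnStreamline` — S (Cauchy–Schwarz pointwise + `integral_mono`).
* `stub_annulusLogEnergy : AnnulusLogEnergy` — M, Mathlib-only (sibling card `three-clocks-fat-core-ladder` §1: the
  single-level log ceiling = barrier note B1; kept as the line's negative benchmark, not load-bearing in §4).
* `stub_loudOfContrast : ContrastFamily → ∃ f, … ∧ ForwardRegularLoudFamilyFor f` — M–L, provable now (energy equality on
  `[0,T]`, forward energy bound ⇒ `meanDissipation = limsup` of mean injection; split of the injection of `twoHalf g (μh)`).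
* `stub_eternalisation : ∀ ν f, 0 < ν → IsSmooth f → EternalisationAt ν f` — XL, OWNED BY CRUX 3005 (its lines
  `generic-point-eternalisation` / `cesaro-serrin-moment-eternal`); closes here by import when it lands there.
* `stub_contrastFamily : ContrastFamily` — the RESIDUAL (conjecture-grade; lead).  Its refutation at fixed arena would be
  a laminarisation / contrast-free-transport theorem; its proof is the zeroth law for that arena.

Disproof obligations: no `Cruxes/ChainRealisation/Disproof.lean` is published yet (payload `disproof_path` is another seat's
folder, not mounted; `ledger crux ls`: absent at registration).  Honoured from the consequent's standing file
`Cruxes/ChainThesis/Disproof.lean` §1–§6: the residual keeps `HasZeroMean` (g, h mean-free ⇒ `twoHalf` mean-free, §0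
`arena_hasZeroMean`), the energy ceiling is explicit and forward-pointwise (§4 honesty), `ν_j → 0` is kept, and
`not_chainThesisBoundedEnstrophy` is untouched (per-`j` enstrophy bounds only).
-/

noncomputable section

set_option linter.dupNamespace false
set_option linter.unusedSectionVars false

open MeasureTheory Set Filter Topology
open scoped InnerProductSpace
open Literature.Analysis.FunctionSpaces Literature.Analysis.FunctionSpaces.Torus
open Literature.Analysis.FluidPDE

namespace Summit.AnomalousDissipation.AnomalousDissipation.Cruxes.ChainRealisation.SeparatrixFluxPinning

open Summit.AnomalousDissipation.AnomalousDissipation.Theses.MarginalStabilityChain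

/-- Local notation: the torus `T³`. -/
local notation "𝕋³" => UnitAddTorus (Fin 3)
/-- Local notation: velocity values. -/
local notation "E³" => EuclideanSpace ℝ (Fin 3)
/-- Local notation: the planar torus `T²`. -/
local notation "𝕋²" => UnitAddTorus (Fin 2)
/-- Local notation: planar velocity values. -/
local notation "E²" => EuclideanSpace ℝ (Fin 2)

/-! ## §0 The antecedents are inert; the arena force -/

/-- Every line for `ChainRealisation` may end in `ChainThesis` (the unit-cell antecedents are formally unused). -/
theorem chainRealisation_of_chainThesis (h : ChainThesis) : ChainRealisation := fun _ _ _ => h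

/-- The ARENA FORCE of the card: `f(x) = (g(x₀,x₁), μ h(x₀,x₁))`, a `2½`-dimensional steady force built from a planar
field `g` and an axial pattern `h` with amplitude `μ` (tree `Torus.twoHalf`). -/
abbrev arenaForce (g : 𝕋² → E²) (h : 𝕋² → ℝ) (μ : ℝ) : 𝕋³ → E³ :=
  twoHalf g (μ • h)

/-- Evaluation of the arena force: planar components `g`, axial component `μ h`. -/
theorem arenaForce_apply_two (g : 𝕋² → E²) (h : 𝕋² → ℝ) (μ : ℝ) (x : 𝕋³) :
    arenaForce g h μ x 2 = μ * h (planarProj x) := by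
  simp [arenaForce, twoHalf_apply_two]

/-- Evaluation of the arena force: planar components. -/
theorem arenaForce_apply_castSucc (g : 𝕋² → E²) (h : 𝕋² → ℝ) (μ : ℝ) (x : 𝕋³) (j : Fin 2) :
    arenaForce g h μ x (Fin.castSucc j) = g (planarProj x) j := by
  simp [arenaForce, twoHalf_apply_castSucc]

/-- The arena force is smooth when `g`, `h` are. -/
theorem arena_isSmooth {g : 𝕋² → E²} {h : 𝕋² → ℝ} (hg : IsSmooth g) (hh : IsSmooth h) (μ : ℝ) :
    IsSmooth (arenaForce g h μ) :=
  hg.twoHalf (hh.smul μ)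

/-- The arena force is solenoidal when `g` is (the axial component does not depend on `x₂`). -/
theorem arena_isDivFree {g : 𝕋² → E²} (hdiv : IsDivFree g) (h : 𝕋² → ℝ) (μ : ℝ) :
    IsDivFree (arenaForce g h μ) :=
  hdiv.twoHalf _

/-- The arena force is mean-free when `g` and `h` are. -/
theorem arena_hasZeroMean {g : 𝕋² → E²} {h : 𝕋² → ℝ} (hg : IsSmooth g) (hh : IsSmooth h)
    (hg0 : HasZeroMean g) (hh0 : HasZeroMean h) (μ : ℝ) : HasZeroMean (arenaForce g h μ) := by
  have hμh : IsSmooth (μ • h) := hh.smul μ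
  have hpairC : Continuous (fun y : 𝕋² => planarEmbed (g y, (μ • h) y)) :=
    planarEmbed.continuous.comp (hg.continuous.prodMk hμh.continuous)
  have hb : AEStronglyMeasurable (fun y : 𝕋² => planarEmbed (g y, (μ • h) y)) volume :=
    hpairC.aestronglyMeasurable
  have hint : Integrable (fun y : 𝕋² => (g y, (μ • h) y)) volume :=
    hg.integrable.prodMk hμh.integrable
  unfold HasZeroMean arenaForce
  calc ∫ x, twoHalf g (μ • h) x
      = ∫ x : 𝕋³, (fun y : 𝕋² => planarEmbed (g y, (μ • h) y)) (planarProj x) := rfl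
    _ = ∫ y : 𝕋², planarEmbed (g y, (μ • h) y) := integral_comp_planarProj hb
    _ = planarEmbed (∫ y : 𝕋², (g y, (μ • h) y)) := (planarEmbed.integral_comp_comm hint)
    _ = planarEmbed ((∫ y, g y), ∫ y, (μ • h) y) := by
        rw [integral_pair hg.integrable hμh.integrable]
    _ = 0 := by
        have hg0' : ∫ y, g y = 0 := hg0
        have hh0' : ∫ y, (μ • h) y = 0 := by
          have : ∫ y, h y = 0 := hh0
          simp [Pi.smul_apply, smul_eq_mul, integral_const_mul, this]
        rw [hg0', hh0']
        exact map_zero planarEmbed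

/-! ## §1 Card first lemmas (typed in `SketchIdeator2.lean` §1–§3; provable now; registered stubs, statements
written out over tree vocabulary so that the landed helper theorems match them by name + signature) -/

/-- Stub (M) **Axial momentum tested against `x₂`-independent functions is pressure-free**
(`AxialMomentumTestIdentity` of the sketch).  For a classical solution of NS on a convex time set `S` and a smooth
planar test `ψ : T² → ℝ` lifted to `φ = ψ ∘ planarProj` (so `∂₂φ = 0`):
`d/dt ∫ φ u₂ = ∫ u₂ (u₀∂₀φ + u₁∂₁φ) + ν ∫ u₂ Δφ + ∫ φ f₂` — the pressure term `∫ φ ∂₂p = -∫ p ∂₂φ` vanishes and the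
convective term is `-∫ φ div(u₂u) = ∫ u₂ u·∇φ` with `u·∇φ = u_h·∇_hφ`.  Tools: `IsClassicalNSSolutionOn.momentum`
(component 2), `partialDeriv_comp_planarProj_last`, `integral_partialDeriv_eq_zero_holds`,
`integral_inner_convect_add_eq_zero`, `integral_inner_laplacian_comm`, `IsSmoothSpaceTimeOn.hasDerivWithinAt_integral`
(pattern: `IsClassicalNSSolutionOn.energy_balance_holds`). -/
theorem stub_axialMomentumTestIdentity :
    ∀ {S : Set ℝ} {ν : ℝ} {f u : ℝ → 𝕋³ → E³} {p : ℝ → 𝕋³ → ℝ}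
      (_h : IsClassicalNSSolutionOn S ν f u p) (_hS : Convex ℝ S) (ψ : 𝕋² → ℝ) (_hψ : IsSmooth ψ)
      {t : ℝ} (_ht : t ∈ S),
      HasDerivWithinAt (fun s => ∫ x, ψ (planarProj x) * u s x 2)
        ((∫ x, u t x 2 *
            ∑ j : Fin 2, u t x (Fin.castSucc j) * partialDeriv (Fin.castSucc j) (ψ ∘ planarProj) x) +
          ν * (∫ x, u t x 2 * laplacian (ψ ∘ planarProj) x) +
          ∫ x, ψ (planarProj x) * f t x 2)
        S t :=
  Summit.AnomalousDissipation.AnomalousDissipation.Theorems.ChainRealisation.SeparatrixFluxPinning.stub_axialMomentumTestIdentity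

/-- Stub (S–M) **Rhines–Young constraint with source, for axial momentum** (`PinnedSeparatrixFlux` of the sketch).
Stationary mean objects on `T²`: mean axial velocity `W`, mean planar velocity `V = ∇⊥Ψ`, total eddy flux `T` of axial
momentum, axial source `h`, with the weak stationary balance `∫ (W V + T)·∇ψ + ν W Δψ + h ψ = 0` for all smooth `ψ`.
Then for every smooth `G : ℝ → ℝ` the ADVECTIVE flux across the level sets of `Ψ` drops out (`V·∇Ψ = 0` pointwise) and
`∫ G'(Ψ) T·∇Ψ = -∫ h·G(Ψ) - ν ∫ W Δ(G∘Ψ)` (test with `ψ = G ∘ Ψ`; chain rule `∇(G∘Ψ) = G'(Ψ)∇Ψ` via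
`Torus.inner_gradient_left` / `fderiv_apply_eq_sum_partialDeriv`). [cite: RhinesYoung1982, §2] -/
theorem stub_pinnedSeparatrixFlux :
    ∀ (ν : ℝ) (h W Ψ : 𝕋² → ℝ) (V T : 𝕋² → E²),
      IsSmooth h → IsSmooth W → IsSmooth Ψ → IsSmooth V → IsSmooth T →
      (∀ x, V x 0 = partialDeriv 1 Ψ x ∧ V x 1 = -partialDeriv 0 Ψ x) →
      (∀ ψ : 𝕋² → ℝ, IsSmooth ψ →
        ∫ x, (W x * ⟪V x, gradient ψ x⟫_ℝ + ⟪T x, gradient ψ x⟫_ℝ + ν * (W x * laplacian ψ x) +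
          h x * ψ x) = 0) →
      ∀ G : ℝ → ℝ, ContDiff ℝ (⊤ : ℕ∞) G →
        ∫ x, deriv G (Ψ x) * ⟪T x, gradient Ψ x⟫_ℝ =
          -(∫ x, h x * G (Ψ x)) - ν * ∫ x, W x * laplacian (G ∘ Ψ) x :=
  Summit.AnomalousDissipation.AnomalousDissipation.Theorems.ChainRealisation.SeparatrixFluxPinning.stub_pinnedSeparatrixFlux

/-- Stub (S) **Eddy-energy floor on a mean streamline** (`PinnedSeparatrixFlux → EddyEnergyOnStreamline` of the sketch):
from the pinned identity and `‖T‖ ≤ k` pointwise, for `G' ≥ 0`: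
`|∫ h G(Ψ)| ≤ ∫ G'(Ψ) k ‖∇Ψ‖ + |ν| |∫ W Δ(G∘Ψ)|` (Cauchy–Schwarz pointwise, `abs_integral_le_integral_abs`,
`integral_mono`). -/
theorem stub_eddyEnergyOnStreamline :
    (∀ (ν : ℝ) (h W Ψ : 𝕋² → ℝ) (V T : 𝕋² → E²),
      IsSmooth h → IsSmooth W → IsSmooth Ψ → IsSmooth V → IsSmooth T →
      (∀ x, V x 0 = partialDeriv 1 Ψ x ∧ V x 1 = -partialDeriv 0 Ψ x) →
      (∀ ψ : 𝕋² → ℝ, IsSmooth ψ →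
        ∫ x, (W x * ⟪V x, gradient ψ x⟫_ℝ + ⟪T x, gradient ψ x⟫_ℝ + ν * (W x * laplacian ψ x) +
          h x * ψ x) = 0) →
      ∀ G : ℝ → ℝ, ContDiff ℝ (⊤ : ℕ∞) G →
        ∫ x, deriv G (Ψ x) * ⟪T x, gradient Ψ x⟫_ℝ =
          -(∫ x, h x * G (Ψ x)) - ν * ∫ x, W x * laplacian (G ∘ Ψ) x) →
    ∀ (ν : ℝ) (h W Ψ k : 𝕋² → ℝ) (V T : 𝕋² → E²) (G : ℝ → ℝ),
      IsSmooth h → IsSmooth W → IsSmooth Ψ → IsSmooth V → IsSmooth T → Continuous k →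
      ContDiff ℝ (⊤ : ℕ∞) G → (∀ s, 0 ≤ deriv G s) → (∀ x, ‖T x‖ ≤ k x) →
      (∀ x, V x 0 = partialDeriv 1 Ψ x ∧ V x 1 = -partialDeriv 0 Ψ x) →
      (∀ ψ : 𝕋² → ℝ, IsSmooth ψ →
        ∫ x, (W x * ⟪V x, gradient ψ x⟫_ℝ + ⟪T x, gradient ψ x⟫_ℝ + ν * (W x * laplacian ψ x) +
          h x * ψ x) = 0) →
      |∫ x, h x * G (Ψ x)| ≤
        (∫ x, deriv G (Ψ x) * k x * ‖gradient Ψ x‖) + |ν| * |∫ x, W x * laplacian (G ∘ Ψ) x| :=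
  Summit.AnomalousDissipation.AnomalousDissipation.Theorems.ChainRealisation.SeparatrixFluxPinning.stub_eddyEnergyOnStreamline

/-- Stub (M, Mathlib-only) **Annulus log-energy inequality** (polar form; sibling card `three-clocks-fat-core-ladder`
§1 = barrier note B1, the single-level log ceiling; the line's negative benchmark).  If a continuous planar field
`(u₁,u₂)` has circulation `Γ` around every circle `|x| = r`, `δ ≤ r ≤ R`, then
`Γ²/(2π)·log(R/δ) ≤ ∫_δ^R r ∫₀^{2π} |u(r,θ)|² dθ dr` (Cauchy–Schwarz on each circle: `Γ² ≤ 2π r² ∫₀^{2π} |u|² dθ`,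
then `∫_δ^R dr/r = log(R/δ)`; continuity of the parametric circle integrals gives interval integrability). -/
theorem stub_annulusLogEnergy :
    ∀ (u₁ u₂ : ℝ → ℝ → ℝ) (δ R Γ : ℝ),
      Continuous (fun q : ℝ × ℝ => (u₁ q.1 q.2, u₂ q.1 q.2)) → 0 < δ → δ ≤ R →
      (∀ r ∈ Icc δ R,
        ∫ θ in (0 : ℝ)..(2 * Real.pi),
          r * (-Real.sin θ * u₁ (r * Real.cos θ) (r * Real.sin θ) +
                Real.cos θ * u₂ (r * Real.cos θ) (r * Real.sin θ)) = Γ) →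
      Γ ^ 2 / (2 * Real.pi) * Real.log (R / δ) ≤
        ∫ r in δ..R, r * ∫ θ in (0 : ℝ)..(2 * Real.pi),
          (u₁ (r * Real.cos θ) (r * Real.sin θ) ^ 2 + u₂ (r * Real.cos θ) (r * Real.sin θ) ^ 2) :=
  Summit.AnomalousDissipation.AnomalousDissipation.Theorems.ChainRealisation.SeparatrixFluxPinning.stub_annulusLogEnergy

/-! ## §2 The T³ side: forward loud MEAN-ZERO family for ONE force, and ETERNALISATION decomposed
(reshape v3 of `stub_eternalisation`, crux 3005's lemma, over the landed ergodic vocabulary of the BaireTransfer line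
`Theorems.DenseLoudDesignerForces.Ergodic`: `Hsp` (mean-zero energy space), `rep`, `energyAvg`, `dissipAvg`, `IsNSPhase`,
`IsInvariantMeasure`; mean-zero velocities are imposed because `Hsp` is the mean-zero slice — harmless: the force is
mean-free, the mean is conserved, and the residual may choose mean-zero data) -/

open Summit.AnomalousDissipation.AnomalousDissipation.Theorems.DenseLoudDesignerForces.Ergodic
open Literature.Analysis.FluidPDE.Torus

/-- **Forward-regular loud bounded MEAN-ZERO family for ONE force**: `ν_j → 0`, classical solutions on `[0,∞) × T³`
with mean-zero slices, enstrophy bounded on `t ≥ 0` (a `j`-dependent bound; for classical solutions on `[0,∞)` equivalent to a bound on `t ≥ 1`), limsup-mean energy `≤ E`, limsup-mean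
dissipation `≥ ε`. -/
def ForwardRegularLoudFamilyZM (f : 𝕋³ → E³) : Prop :=
  ∃ (ν : ℕ → ℝ) (u : ℕ → ℝ → 𝕋³ → E³) (p : ℕ → ℝ → 𝕋³ → ℝ),
    (∀ j, 0 < ν j) ∧ Tendsto ν atTop (nhds 0) ∧
    (∀ j, IsClassicalNSSolutionOn (Set.Ici 0) (ν j) (fun _ => f) (u j) (p j)) ∧
    (∀ j, ∃ M : ℝ, ∀ t : ℝ, 0 ≤ t → gradNormSq (u j t) ≤ M) ∧
    (∀ j t, 0 ≤ t → HasZeroMean (u j t)) ∧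
    (∃ E : ℝ, ∀ j, meanEnergy (u j) ≤ E) ∧
    ∃ ε : ℝ, 0 < ε ∧ ∀ j, ε ≤ meanDissipation (ν j) (u j)

/-- **Eternalisation at one viscosity, mean-zero class** (crux 3005's `EternalisationAt` with the extra hypothesis
that the forward solution has mean-zero slices): a forward classical solution with eventually bounded enstrophy and
good limsup budgets yields an ETERNAL classical solution of the same system with dissipation `≥ ε/2` and energy
`≤ 16‖f‖₂²·max(E,1)²/ε²`. Derived below from four stubs (`eternalisationZM_of`). -/
def EternalisationAtZM (ν : ℝ) (f : 𝕋³ → E³) : Prop :=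
  ∀ (u : ℝ → 𝕋³ → E³) (p : ℝ → 𝕋³ → ℝ) (E ε : ℝ),
    IsClassicalNSSolutionOn (Set.Ici 0) ν (fun _ => f) u p →
    (∃ M : ℝ, ∀ t : ℝ, 0 ≤ t → gradNormSq (u t) ≤ M) →
    (∀ t : ℝ, 0 ≤ t → HasZeroMean (u t)) →
    meanEnergy u ≤ E → 0 < ε → ε ≤ meanDissipation ν u →
    ∃ (v : ℝ → 𝕋³ → E³) (q : ℝ → 𝕋³ → ℝ),
      IsClassicalNSSolutionOn Set.univ ν (fun _ => f) v q ∧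
      meanEnergy v ≤ 16 * (∫ x, ‖f x‖ ^ 2) * (max E 1) ^ 2 / ε ^ 2 ∧
      ε / 2 ≤ meanDissipation ν v

/-- Glue (kernel-checked): eternalisation (mean-zero class) at every viscosity of ONE smooth solenoidal mean-zero force
+ a forward-regular loud mean-zero family for it ⇒ `ChainThesis`. -/
theorem chainThesis_of_forwardFamilyZM {f : 𝕋³ → E³}
    (hf : IsSmooth f) (hdiv : IsDivFree f) (hmean : HasZeroMean f)
    (hEt : ∀ ν : ℝ, 0 < ν → EternalisationAtZM ν f) (hC : ForwardRegularLoudFamilyZM f) :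
    ChainThesis := by
  obtain ⟨ν, u, p, hν, hν0, hsol, hM, hzm, ⟨E, hE⟩, ε, hε, hεle⟩ := hC
  have key : ∀ j, ∃ (v : ℝ → 𝕋³ → E³) (q : ℝ → 𝕋³ → ℝ),
      IsClassicalNSSolutionOn Set.univ (ν j) (fun _ => f) v q ∧
      meanEnergy v ≤ 16 * (∫ x, ‖f x‖ ^ 2) * (max E 1) ^ 2 / ε ^ 2 ∧
      ε / 2 ≤ meanDissipation (ν j) v :=
    fun j => hEt (ν j) (hν j) (u j) (p j) E ε (hsol j) (hM j) (hzm j) (hE j) hε (hεle j)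
  choose v q hv using key
  exact ⟨f, hf, hdiv, hmean, ν, v, q, hν, hν0, fun j => (hv j).1, ⟨_, fun j => (hv j).2.1⟩, ε / 2,
    by positivity, fun j => (hv j).2.2⟩

/-! ### §2a Bricks toward the forward phase: the `H²` absorbing bound at fixed `ν` (wave 3–4 stubs)

The fixed-`ν` construction of the phase starts with a priori bounds of the given classical solution in every `Hᵏ`
uniformly on `t ≥ 1`.  The first rung — enstrophy bounded ⇒ `‖Δu(t)‖₂²` bounded for `t ≥ 1` — is within reach of the
tree (`TorusClassicalH1Balance`, `TorusClassicalHnBalance`, `TorusEnstrophyTrilinear`, `TorusSobolevSup`,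
`TorusSobolevL6`, Poincaré) and is registered as four stubs: the time-averaged `H²` bound from the `H¹` balance, the
uniform Gronwall lemma, the `H²` nonlinear estimate, and their assembly. -/

/-- Stub S1 (M–L) **time-averaged `H²` bound**: for a forward classical solution with `‖∇u(t)‖₂² ≤ M` the `H¹` balance
`d/dt ½‖∇u‖² = −ν‖Δu‖² + ∫⟪(u·∇)u − F, Δu⟫` (`hasDerivWithinAt_half_gradNormSq`), the dissipation form of the
trilinear estimate `|∫⟪(u·∇)u, Δu⟫| ≤ (ν/2)‖Δu‖² + (8K⁴/ν³)(‖∇u‖²)³`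
(`Torus.abs_integral_inner_convect_laplacian_le_dissipation`) and `|∫⟪F, Δu⟫| ≤ (ν/4)‖Δu‖² + ‖F‖₂²/ν` give, after
integration over `[t, t+1]`, `(ν/4)∫ₜ^{t+1}‖Δu‖² ≤ M/2 + 8K⁴M³/ν³ + ‖F‖₂²/ν` (Foias–Manley–Rosa–Temam 2001 Ch. II (A.44)–(A.46)). -/
theorem stub_timeAvgLaplacianBound :
    ∀ (ν M : ℝ) (F : 𝕋³ → E³) (u : ℝ → 𝕋³ → E³) (p : ℝ → 𝕋³ → ℝ),
      0 < ν → IsSmooth F → IsClassicalNSSolutionOn (Set.Ici 0) ν (fun _ => F) u p →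
      (∀ t : ℝ, 0 ≤ t → gradNormSq (u t) ≤ M) →
      ∃ C : ℝ, ∀ t : ℝ, 0 ≤ t → ∫ s in t..t + 1, (∫ x, ‖laplacian (u s) x‖ ^ 2) ≤ C :=
  Summit.AnomalousDissipation.AnomalousDissipation.Theorems.ChainRealisation.SeparatrixFluxPinning.stub_timeAvgLaplacianBound

/-- Stub S2 (M, real analysis) **the uniform Gronwall lemma** (Temam, *Infinite-Dimensional Dynamical Systems*, Ch. III
Lemma 1.1; Foias–Manley–Rosa–Temam 2001 Ch. II (A.61)): if `y' ≤ g y + h` from the right on `[t₀, ∞)` with `y, g, h ≥ 0`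
continuous and the sliding integrals `∫ₜ^{t+r} g ≤ a₁`, `∫ₜ^{t+r} h ≤ a₂`, `∫ₜ^{t+r} y ≤ a₃` for all `t ≥ t₀`, then
`y(t + r) ≤ (a₃/r + a₂) e^{a₁}` for all `t ≥ t₀`. -/
theorem stub_uniformGronwall :
    ∀ (y y' g h : ℝ → ℝ) (t₀ r a₁ a₂ a₃ : ℝ), 0 < r →
      ContinuousOn y (Set.Ici t₀) → ContinuousOn g (Set.Ici t₀) → ContinuousOn h (Set.Ici t₀) →
      (∀ s : ℝ, t₀ ≤ s → HasDerivWithinAt y (y' s) (Set.Ici s) s) →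
      (∀ s : ℝ, t₀ ≤ s → y' s ≤ g s * y s + h s) →
      (∀ s : ℝ, t₀ ≤ s → 0 ≤ y s) → (∀ s : ℝ, t₀ ≤ s → 0 ≤ g s) → (∀ s : ℝ, t₀ ≤ s → 0 ≤ h s) →
      (∀ t : ℝ, t₀ ≤ t → ∫ s in t..t + r, g s ≤ a₁) →
      (∀ t : ℝ, t₀ ≤ t → ∫ s in t..t + r, h s ≤ a₂) →
      (∀ t : ℝ, t₀ ≤ t → ∫ s in t..t + r, y s ≤ a₃) →
      ∀ t : ℝ, t₀ ≤ t → y (t + r) ≤ (a₃ / r + a₂) * Real.exp a₁ :=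
  Summit.AnomalousDissipation.AnomalousDissipation.Theorems.ChainRealisation.SeparatrixFluxPinning.stub_uniformGronwall

/-- Stub S3 (L) **the `H²` nonlinear estimate on `T³`**: for smooth solenoidal mean-zero `u` with `‖∇u‖₂² ≤ M`,
`|∫⟪(u·∇)u, Δ²u⟫| ≤ (ν/2)‖∇Δu‖₂² + C(1 + ‖Δu‖₂²)²` with `C = C(ν, M)`.  Proof: `∫⟪A, ΔB⟫ = −Σₘ∫⟪∂ₘA, ∂ₘB⟫` with
`A = (u·∇)u`, `B = Δu`; `∂ₘ((u·∇)u) = (∂ₘu·∇)u + (u·∇)∂ₘu`; `‖(∂ₘu·∇)u‖₂² ≤ ∫|∇u|⁴ ≤ K‖∇u‖₂‖Δu‖₂³`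
(`Torus.integral_sum_norm_sq_partialDeriv_sq_le`, Ladyzhenskaya in 3-D); `‖(u·∇)∂ₘu‖₂² ≤ ‖u‖_∞²·d·‖Δu‖₂²`
(`Torus.gradNormSq_partialDeriv_le`) with `‖u‖_∞² ≤ K'(‖u‖₂² + ‖∇u‖₂² + ΣΣ‖∂ᵢ∂ⱼu‖₂²) ≤ K''(M + ‖Δu‖₂²)`
(`Torus.norm_sq_le_sobolev_two_of_isSmooth`, Poincaré `four_pi_sq_mul_integral_norm_sq_le_gradNormSq`); then
Cauchy–Schwarz and Young. -/
theorem stub_h2NonlinearEstimate :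
    ∀ (ν M : ℝ), 0 < ν → 0 ≤ M → ∃ C : ℝ, ∀ u : 𝕋³ → E³, IsSmooth u → IsDivFree u → HasZeroMean u →
      gradNormSq u ≤ M →
      |∫ x, ⟪convect u u x, laplacian (laplacian u) x⟫_ℝ| ≤
        ν / 2 * gradNormSq (laplacian u) + C * (1 + ∫ x, ‖laplacian u x‖ ^ 2) ^ 2 :=
  Summit.AnomalousDissipation.AnomalousDissipation.Theorems.ChainRealisation.SeparatrixFluxPinning.stub_h2NonlinearEstimate

/-- Stub S4 (M–L) **the `H²` absorbing bound**: a forward classical solution with mean-zero slices and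
`‖∇u(t)‖₂² ≤ M` on `t ≥ 0` has `‖Δu(t)‖₂² ≤ M₂` on `t ≥ 1`.  Proof: with `y(t) = ‖Δu(t)‖₂²`, the `H²` balance
(`hasDerivWithinAt_half_integral_norm_sq_laplacian_iterate`, `n = 1`) and S3 give
`y' ≤ [2C(2 + y) + 1]·y + (2C + ‖ΔF‖₂²)` from the right; S1 bounds `∫ₜ^{t+1} y` and hence `∫ₜ^{t+1} g`; the uniform
Gronwall lemma S2 (`r = 1`, `t₀ = 0`) gives `y(t+1) ≤ (C₁ + 2C + ‖ΔF‖₂²) e^{4C+1+2CC₁}` (FMRT 2001 Ch. II §A.4; Constantin–Foias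
1988 Ch. 13). -/
theorem stub_laplacianSupBound :
    ∀ (ν M : ℝ) (F : 𝕋³ → E³) (u : ℝ → 𝕋³ → E³) (p : ℝ → 𝕋³ → ℝ),
      0 < ν → IsSmooth F → IsClassicalNSSolutionOn (Set.Ici 0) ν (fun _ => F) u p →
      (∀ t : ℝ, 0 ≤ t → gradNormSq (u t) ≤ M) → (∀ t : ℝ, 0 ≤ t → HasZeroMean (u t)) →
      ∃ M₂ : ℝ, ∀ t : ℝ, 1 ≤ t → ∫ x, ‖laplacian (u t) x‖ ^ 2 ≤ M₂ :=
  Summit.AnomalousDissipation.AnomalousDissipation.Theorems.ChainRealisation.SeparatrixFluxPinning.stub_laplacianSupBound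

/-! ### §2b The forward phase (the remaining fixed-`ν` PDE debt), RESHAPED (lead -1, 2026-08-16) into six registered
stubs + kernel-checked glue, and the ergodic chain — v7: ALL SIX LANDED (B1 p99420, B2 p102634 (+p99478), B3 p103551
(+p100948 p100955 p102120), B4 p99396, B5 p103422 (+p99475 p101089 p102843), B6 p103421 (+p99889 p101791)); the assembly
`forwardPhaseH2_holds` / `eternalisationZM_holds` / `chainRealisation_of_contrastFamily` is the Theorems file
`…MarginalStabilityChainChainRealisationForwardPhase.lean` (p105517).  The ONLY `sorry` left in this skeleton is the
residual `stub_contrastFamily`.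

The phase through a forward classical solution `u` with `H¹`/`H²` bounds is built from COMPACT LIMITS OF TIME-TRANSLATES:
(B1) the nonlinear word estimate of the `H^m` energy method (`stub_convectWordEstimate`, sup × `L²` only, `m ≥ 3`; LANDED p99420);
(B2) the all-order bootstrap `sup_{t ≥ 0} E_k(u(t)) < ∞` for every `k` (`stub_sobolevBootstrap`: word-level balances of
classical NS + (B1) + the landed uniform Gronwall lemma and `H²` rung); (B3) bounds of ALL space–time derivatives of the
lifts of `u` and of the normalised pressure on `(0,∞) × ℝ³` (`stub_liftBounds`: `‖∂^w ∂ₜ^{j+1} u‖₂ ≤ ‖∂^w ∂ₜ^j(νΔu − (u·∇)u + F)‖₂`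
because `∂^w∂ₜ^{j+1}u` is solenoidal, then Sobolev); (B4) Arzelà–Ascoli with all derivatives on the open half-space
(`stub_ascoliSmooth`, pure calculus; the tree's `ContDiffUniformLimit` passes smoothness to the limit); (B5) COMPACT LIMITS OF
SHIFTS (`stub_compactLimitsOfShifts`, lead: (B3)+(B4) ⇒ every sequence of forward time-translates of `u` has a subsequence
converging, in `L²` and `H¹` locally uniformly in time, to a forward classical mean-zero solution — limits of classical
solutions with converging 2-jets are classical, bounded shifts by uniform continuity); (B6) the PHASE from compact limits
(`stub_phaseOfCompactLimits`: `K` = time-0 slices of the limit trajectories, `φ` by classical uniqueness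
`Torus.IsClassicalNSSolutionOn.velocity_unique_of_mem`, joint continuity and enstrophy continuity by the sub-subsequence
principle).  Composition `forwardPhaseH2_of` below (sorry-free glue). -/

/-- Stub B1 (L) **the nonlinear word estimate of the `H^m` energy method on `T³`** (sup × `L²` only).  For `m ≥ 2`, `A ≥ 0`
there is `C = C(ν, m, A)` such that every smooth solenoidal `u` with `E_m(u) ≤ A` (`sobolevEnergy m u`, all ordered words of
length `≤ m`) satisfies `|∑_{|w| ≤ m+1} ∫⟪∂^w((u·∇)u), ∂^w u⟫| ≤ (ν/2) E_{m+2}(u) + C (1 + E_{m+1}(u))`.  Proof: for `w = i :: w'`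
move `∂ᵢ` across (`∫⟪∂ᵢf, g⟫ = −∫⟪f, ∂ᵢg⟫`), so the term is `≤ ‖∂^{w'}((u·∇)u)‖₂ ‖∂ᵢ∂^w u‖₂` and
`∑ ‖∂ᵢ∂^w u‖₂² ≤ E_{m+2}(u)`; expand `∂^{w'}(u_j ∂_j u)` by `Torus.wordDeriv_smul` into `∂^α u_j · ∂^β∂_j u`, `|α|+|β| = |w'| ≤ m`,
and put the SUP norm (`Torus.exists_norm_sq_wordDeriv_le`: `‖∂^α f‖²_∞ ≤ K(E_a+E_{a+1}+E_{a+2})(f)` on `T³`) on `∂^α u_j` when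
`|α| ≤ m − 1` (then `E_{|α|+2} ≤ E_{m+1}` and the `L²` factor is `≤ E_m ≤ A` unless `|α| ≤ m−2`, when it is `≤ E_{m+1}`), and on
`∂_j u` when `|α| = m` (`E_3 ≤ A` if `m ≥ 3`, `= E_{m+1}` if `m = 2`): every product is `≤ C(K,A)(1 + E_{m+1}(u))`; the
word of length `0` contributes `|∫⟪(u·∇)u, u⟫| ≤ C(A)`.  (Majda 1984 Ch. 2 Prop. 2.1; FMRT 2001 Ch. II §A.4.) -/
theorem stub_convectWordEstimate :
    ∀ (ν : ℝ) (m : ℕ) (A : ℝ), 0 < ν → 2 ≤ m → ∃ C : ℝ, ∀ u : 𝕋³ → E³, IsSmooth u → IsDivFree u →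
      sobolevEnergy m u ≤ A →
      |∑ n ∈ Finset.range (m + 2), ∑ v : Fin n → Fin 3,
          ∫ x, ⟪wordDeriv (List.ofFn v) (convect u u) x, wordDeriv (List.ofFn v) u x⟫_ℝ| ≤
        ν / 2 * sobolevEnergy (m + 2) u + C * (1 + sobolevEnergy (m + 1) u) :=
  Summit.AnomalousDissipation.AnomalousDissipation.Theorems.ChainRealisation.SeparatrixFluxPinning.stub_convectWordEstimate

/-- Stub B2 (L) **the all-order Sobolev bootstrap** (given B1): a forward classical solution with mean-zero slices,
`‖∇u(t)‖₂² ≤ M` on `t ≥ 0` and `‖Δu(t)‖₂² ≤ M₂` on `t ≥ 1` has `sup_{t ≥ 0} E_k(u(t)) < ∞` for every `k`.  On `[0,2]` by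
continuity of `t ↦ E_k(u(t))` (`Torus.continuousOn_integral_of_continuousOn_stLift`); on `[1,∞)` by induction on `m ≥ 3` with
IH `sup E_{m−1} ≤ A ∧ sup_t ∫ₜ^{t+1} E_m ≤ B`: the WORD BALANCE of classical NS (`d/dt ½∫‖∂^w u‖² = −ν‖∇∂^w u‖₂² −
∫⟪∂^w((u·∇)u), ∂^w u⟫ + ∫⟪∂^w F, ∂^w u⟫`, the pressure drops since `∂^w u` is solenoidal; tools
`Torus.timeDerivWithin_wordDeriv_comm`, `isSmoothSpaceTimeOn_wordDeriv`, `IsSmoothSpaceTimeOn.hasDerivWithinAt_integral`,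
pattern `TorusClassicalHnBalance`) summed over `|w| ≤ m` gives `E_m' ≤ −ν E_{m+1} + C(1 + E_m)` by B1, so the landed uniform
Gronwall lemma (`Theorems…StubUniformGronwall.stub_uniformGronwall`, `r = 1`) bounds `E_m` and integration bounds `∫ₜ^{t+1}E_{m+1}`;
base `m = 3`: `E_2 ≤ C(M, M₂)` (Poincaré, `∑ᵢⱼ‖∂ᵢ∂ⱼu‖² = ‖Δu‖²`) and `∫ₜ^{t+1} E_3 ≤ B` from the `H²` balance with the landed
`stub_h2NonlinearEstimate` (`E_3 − E_2 = ‖∇Δu‖₂²` by Plancherel).  (FMRT 2001 Ch. II §A.4–A.5; Constantin–Foias 1988 Ch. 13.) -/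
theorem stub_sobolevBootstrap :
    (∀ (ν : ℝ) (m : ℕ) (A : ℝ), 0 < ν → 2 ≤ m → ∃ C : ℝ, ∀ u : 𝕋³ → E³, IsSmooth u → IsDivFree u →
      sobolevEnergy m u ≤ A →
      |∑ n ∈ Finset.range (m + 2), ∑ v : Fin n → Fin 3,
          ∫ x, ⟪wordDeriv (List.ofFn v) (convect u u) x, wordDeriv (List.ofFn v) u x⟫_ℝ| ≤
        ν / 2 * sobolevEnergy (m + 2) u + C * (1 + sobolevEnergy (m + 1) u)) →
    ∀ (ν : ℝ) (F : 𝕋³ → E³) (u : ℝ → 𝕋³ → E³) (p : ℝ → 𝕋³ → ℝ),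
      0 < ν → IsSmooth F → IsClassicalNSSolutionOn (Set.Ici 0) ν (fun _ => F) u p →
      (∀ t : ℝ, 0 ≤ t → HasZeroMean (u t)) →
      (∃ M : ℝ, ∀ t : ℝ, 0 ≤ t → gradNormSq (u t) ≤ M) →
      (∃ M₂ : ℝ, ∀ t : ℝ, 1 ≤ t → ∫ x, ‖laplacian (u t) x‖ ^ 2 ≤ M₂) →
      ∀ k : ℕ, ∃ C : ℝ, ∀ t : ℝ, 0 ≤ t → sobolevEnergy k (u t) ≤ C :=
  Summit.AnomalousDissipation.AnomalousDissipation.Theorems.ChainRealisation.SeparatrixFluxPinning.stub_sobolevBootstrap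

/-- Stub B3 (L–XL) **all space–time derivatives of the lifts are bounded on `(0,∞) × ℝ³`**: for a forward classical solution
with `sup_{t≥0} E_k(u(t)) < ∞` for all `k` (steady smooth solenoidal mean-zero force), every `‖D^m(stLift u)‖` and every
`‖D^m(stLift p̃)‖`, `p̃ = p − p(·,0)` the pressure normalised at the origin, is bounded on `Ioi 0 ×ˢ univ` (honest `iteratedFDeriv` — the lift is
`C^∞` on a neighbourhood of each such point).  Route: (i) time derivatives in Sobolev currency by induction on `j`, WITHOUT the
pressure: `∂^w∂ₜ^{j+1}u` is smooth, solenoidal and `L²`-orthogonal to gradients, so testing the `∂^w∂ₜ^j`-differentiated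
momentum equation against it gives `‖∂^w∂ₜ^{j+1}u‖₂ ≤ ‖∂^w∂ₜ^j(νΔu − (u·∇)u + F)‖₂`, bounded by the `E_k` (Leibniz along words,
`Torus.wordDeriv_smul`, sup bounds `Torus.exists_norm_sq_wordDeriv_le`); (ii) then `∇∂ₜ^j p = ∂ₜ^j(−∂ₜu + νΔu − (u·∇)u + F)` is
bounded with all word derivatives, and `p̃`, `∂ₜ^j p̃` (vanishing at the origin) are bounded by their gradients times the diameter; (iii) sup bounds of all
`∂ₜ^j ∂^w` from Sobolev (`exists_norm_sq_wordDeriv_le`) and `‖iteratedFDeriv m (stLift u)(t,y)‖ ≤ C ∑_{j+|w| ≤ m} ‖∂ₜ^j∂^w u(t, πy)‖`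
(derivatives of the lift along the coordinate frame; `Torus.timeDerivWithin_wordDeriv_comm`, `stLift`/`liftAt` calculus of
`TorusCalculusProofs`, `TorusSpaceTime`). (FMRT 2001 Ch. II §A.5; Constantin–Foias 1988 Ch. 13.) -/
theorem stub_liftBounds :
    ∀ (ν : ℝ) (F : 𝕋³ → E³) (u : ℝ → 𝕋³ → E³) (p : ℝ → 𝕋³ → ℝ),
      0 < ν → IsSmooth F → IsDivFree F → HasZeroMean F →
      IsClassicalNSSolutionOn (Set.Ici 0) ν (fun _ => F) u p →
      (∀ t : ℝ, 0 ≤ t → HasZeroMean (u t)) →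
      (∀ k : ℕ, ∃ C : ℝ, ∀ t : ℝ, 0 ≤ t → sobolevEnergy k (u t) ≤ C) →
      (∀ m : ℕ, ∃ C : ℝ, ∀ z ∈ Set.Ioi (0 : ℝ) ×ˢ (Set.univ : Set (EuclideanSpace ℝ (Fin 3))),
          ‖iteratedFDeriv ℝ m (stLift u) z‖ ≤ C) ∧
      (∀ m : ℕ, ∃ C : ℝ, ∀ z ∈ Set.Ioi (0 : ℝ) ×ˢ (Set.univ : Set (EuclideanSpace ℝ (Fin 3))),
          ‖iteratedFDeriv ℝ m (stLift (fun t x => p t x - p t 0)) z‖ ≤ C) :=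
  Summit.AnomalousDissipation.AnomalousDissipation.Theorems.ChainRealisation.SeparatrixFluxPinning.stub_liftBounds

/-- Stub B4 (L, pure calculus) **Arzelà–Ascoli with all derivatives on the open half-space `(a,∞) × ℝ³`**: a sequence of
`C^∞` maps into a finite-dimensional space whose derivatives of every order are bounded on `Ioi a ×ˢ univ` uniformly in `n`
has a subsequence converging, with all derivatives and uniformly on every compact subset, to a `C^∞` map obeying the same
bounds.  Proof: on a compact `K ⊂ O` each `D^m f_n` is bounded and equi-Lipschitz (mean value inequality on small balls inside
`O` with the bound on `D^{m+1}`), so Arzelà–Ascoli (`BoundedContinuousFunction.arzela_ascoli` / Mathlib `ArzelaAscoli`) gives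
uniformly convergent subsequences; diagonalise over `m` and the exhaustion `K_j = Icc (a + 1/j) j ×ˢ closedBall 0 j`; smoothness
of the limit and `D^m g = lim D^m f_{φ n}` by the tree's `Calculus.contDiffOn_of_tendstoUniformlyOn_iteratedFDeriv`,
`tendstoUniformlyOn_iteratedFDeriv_of_tendstoUniformlyOn` on the open sets `Ioo (a+1/j) j ×ˢ ball 0 j`; bounds pass to the
limit (`norm_iteratedFDeriv_le_of_tendstoUniformlyOn`). (Dieudonné 1960 (7.5.7), (8.6.3).) -/
theorem stub_ascoliSmooth :
    ∀ {G : Type} [NormedAddCommGroup G] [NormedSpace ℝ G] [FiniteDimensional ℝ G]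
      (a : ℝ) (f : ℕ → ℝ × EuclideanSpace ℝ (Fin 3) → G),
      (∀ n, ContDiffOn ℝ (⊤ : ℕ∞) (f n) (Set.Ioi a ×ˢ Set.univ)) →
      (∀ m : ℕ, ∃ C : ℝ, ∀ n, ∀ z ∈ Set.Ioi a ×ˢ (Set.univ : Set (EuclideanSpace ℝ (Fin 3))),
          ‖iteratedFDeriv ℝ m (f n) z‖ ≤ C) →
      ∃ φ : ℕ → ℕ, StrictMono φ ∧ ∃ g : ℝ × EuclideanSpace ℝ (Fin 3) → G,
        ContDiffOn ℝ (⊤ : ℕ∞) g (Set.Ioi a ×ˢ Set.univ) ∧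
        (∀ m : ℕ, ∃ C : ℝ, ∀ z ∈ Set.Ioi a ×ˢ (Set.univ : Set (EuclideanSpace ℝ (Fin 3))),
            ‖iteratedFDeriv ℝ m g z‖ ≤ C) ∧
        ∀ (m : ℕ) (K : Set (ℝ × EuclideanSpace ℝ (Fin 3))), IsCompact K → K ⊆ Set.Ioi a ×ˢ Set.univ →
          TendstoUniformlyOn (fun n => iteratedFDeriv ℝ m (f (φ n))) (iteratedFDeriv ℝ m g) atTop K :=
  Summit.AnomalousDissipation.AnomalousDissipation.Theorems.ChainRealisation.SeparatrixFluxPinning.stub_ascoliSmooth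

/-- Stub B5 (L; lead) **COMPACT LIMITS OF SHIFTS** (given B3, B4): for a forward classical solution with mean-zero slices and
all-order Sobolev bounds, EVERY sequence of forward time-translates `u(sₙ + ·)`, `sₙ ≥ 0`, has a subsequence converging — in
`L²` and in `H¹`, uniformly on every `[0,T]` — to a forward classical mean-zero solution `(v,q)` of the same system.  Unbounded
`sₙ` (wlog `≥ 1`): B3 bounds all derivatives of the translated lifts on `Ioi (−1) ×ˢ univ` (`iteratedFDeriv_comp_add_right`),
B4 (twice: velocity, normalised pressure) extracts limits `g_u, g_p`, periodic in `y` as pointwise limits, which descend to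
`v, q` on `T³`; limits of classical solutions whose 2-jets converge locally uniformly are classical (each term of the momentum
equation, `div`, and the mean are continuous in the 2-jet of the lift: `stLift`/`liftAt` calculus), on `Ici 0 ⊂ Ioi (−1)`;
`L²`/`H¹` convergence on `[0,T] × T³` from `C¹`-uniform convergence on `[0,T] ×` (a fundamental cube).  Bounded `sₙ`:
Bolzano–Weierstrass `sₙ → s⋆`, limit `u(s⋆ + ·)` (time-translation invariance of `IsClassicalNSSolutionOn` for the steady
force), convergence by uniform continuity of `stLift u` and `D(stLift u)` on compacts. -/
theorem stub_compactLimitsOfShifts :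
    (∀ (ν : ℝ) (F : 𝕋³ → E³) (u : ℝ → 𝕋³ → E³) (p : ℝ → 𝕋³ → ℝ),
      0 < ν → IsSmooth F → IsDivFree F → HasZeroMean F →
      IsClassicalNSSolutionOn (Set.Ici 0) ν (fun _ => F) u p →
      (∀ t : ℝ, 0 ≤ t → HasZeroMean (u t)) →
      (∀ k : ℕ, ∃ C : ℝ, ∀ t : ℝ, 0 ≤ t → sobolevEnergy k (u t) ≤ C) →
      (∀ m : ℕ, ∃ C : ℝ, ∀ z ∈ Set.Ioi (0 : ℝ) ×ˢ (Set.univ : Set (EuclideanSpace ℝ (Fin 3))),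
          ‖iteratedFDeriv ℝ m (stLift u) z‖ ≤ C) ∧
      (∀ m : ℕ, ∃ C : ℝ, ∀ z ∈ Set.Ioi (0 : ℝ) ×ˢ (Set.univ : Set (EuclideanSpace ℝ (Fin 3))),
          ‖iteratedFDeriv ℝ m (stLift (fun t x => p t x - p t 0)) z‖ ≤ C)) →
    (∀ {G : Type} [NormedAddCommGroup G] [NormedSpace ℝ G] [FiniteDimensional ℝ G]
      (a : ℝ) (f : ℕ → ℝ × EuclideanSpace ℝ (Fin 3) → G),
      (∀ n, ContDiffOn ℝ (⊤ : ℕ∞) (f n) (Set.Ioi a ×ˢ Set.univ)) →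
      (∀ m : ℕ, ∃ C : ℝ, ∀ n, ∀ z ∈ Set.Ioi a ×ˢ (Set.univ : Set (EuclideanSpace ℝ (Fin 3))),
          ‖iteratedFDeriv ℝ m (f n) z‖ ≤ C) →
      ∃ φ : ℕ → ℕ, StrictMono φ ∧ ∃ g : ℝ × EuclideanSpace ℝ (Fin 3) → G,
        ContDiffOn ℝ (⊤ : ℕ∞) g (Set.Ioi a ×ˢ Set.univ) ∧
        (∀ m : ℕ, ∃ C : ℝ, ∀ z ∈ Set.Ioi a ×ˢ (Set.univ : Set (EuclideanSpace ℝ (Fin 3))),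
            ‖iteratedFDeriv ℝ m g z‖ ≤ C) ∧
        ∀ (m : ℕ) (K : Set (ℝ × EuclideanSpace ℝ (Fin 3))), IsCompact K → K ⊆ Set.Ioi a ×ˢ Set.univ →
          TendstoUniformlyOn (fun n => iteratedFDeriv ℝ m (f (φ n))) (iteratedFDeriv ℝ m g) atTop K) →
    ∀ (ν : ℝ) (F : 𝕋³ → E³) (u : ℝ → 𝕋³ → E³) (p : ℝ → 𝕋³ → ℝ),
      0 < ν → IsSmooth F → IsDivFree F → HasZeroMean F →
      IsClassicalNSSolutionOn (Set.Ici 0) ν (fun _ => F) u p →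
      (∀ t : ℝ, 0 ≤ t → HasZeroMean (u t)) →
      (∀ k : ℕ, ∃ C : ℝ, ∀ t : ℝ, 0 ≤ t → sobolevEnergy k (u t) ≤ C) →
      ∀ s : ℕ → ℝ, (∀ n, 0 ≤ s n) →
        ∃ φ : ℕ → ℕ, StrictMono φ ∧ ∃ (v : ℝ → 𝕋³ → E³) (q : ℝ → 𝕋³ → ℝ),
          IsClassicalNSSolutionOn (Set.Ici 0) ν (fun _ => F) v q ∧ (∀ t : ℝ, 0 ≤ t → HasZeroMean (v t)) ∧
          ∀ T ε : ℝ, 0 ≤ T → 0 < ε → ∀ᶠ n in atTop, ∀ t ∈ Set.Icc 0 T,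
            (∫ x, ‖u (s (φ n) + t) x - v t x‖ ^ 2) ≤ ε ∧
              gradNormSq (fun x => u (s (φ n) + t) x - v t x) ≤ ε :=
  Summit.AnomalousDissipation.AnomalousDissipation.Theorems.ChainRealisation.SeparatrixFluxPinning.stub_compactLimitsOfShifts

/-- Stub B6 (L) **the NS PHASE FROM COMPACT LIMITS OF SHIFTS** (soft).  Let `u` be a forward classical solution with mean-zero
slices (`ν ≥ 0`) such that every sequence of forward translates has a subsequence converging in `L²`/`H¹`, locally uniformly
in time, to a forward classical mean-zero solution (B5).  Let `Traj` = all such limits `(v,q)` (it contains `u(s₀+·)` — constant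
sequences, time-translation invariance — and is translation invariant), `toH w ∈ Hsp` the class of a smooth solenoidal mean-zero
field (`Torus.energySpace`; `MemLp` of continuous maps), `K = {toH (v 0) : (v,q) ∈ Traj}`, and `φ t x = toH (v_x t)` for a CHOSEN
`(v_x, q_x) ∈ Traj` through `x` (`Classical.choose`; junk `x` off `Ici 0 × K`).  Then: `Traj` is sequentially compact modulo B5
(approximate each `v_k` by a translate on `[0,k]`, apply B5, triangle inequality), so `K` is compact (`IsSeqCompact.isCompact`,
`‖toH f − toH g‖² = ∫‖f−g‖²`); two elements of `Traj` with the same time-0 slice coincide on `t ≥ 0`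
(`Torus.IsClassicalNSSolutionOn.velocity_unique_of_mem`, a.e.-equal continuous slices are equal), whence `mapsTo`, `map_zero`,
`map_add`; joint continuity on `Ici 0 ×ˢ K` and `L²`-continuity of `enstrophyObs` on `K` by the sub-subsequence principle
(`tendsto_of_subseq_tendsto`) plus `L²`-continuity of `t ↦ v t` for smooth `v`; `enstrophy_finite` and the trajectory clause
because every point of `K` is the class of a smooth slice of a classical solution (`eGradNormSq` depends on the a.e. class,
`gradNormSq_eq_toReal_eGradNormSq_holds`); `x₀ = toH (u 0)`.  (FMRT 2001 Ch. III §2, Ch. IV §1.) -/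
theorem stub_phaseOfCompactLimits :
    ∀ (ν : ℝ) (F : 𝕋³ → E³) (u : ℝ → 𝕋³ → E³) (p : ℝ → 𝕋³ → ℝ),
      0 ≤ ν → IsClassicalNSSolutionOn (Set.Ici 0) ν (fun _ => F) u p →
      (∀ t : ℝ, 0 ≤ t → HasZeroMean (u t)) →
      (∀ s : ℕ → ℝ, (∀ n, 0 ≤ s n) →
        ∃ φ : ℕ → ℕ, StrictMono φ ∧ ∃ (v : ℝ → 𝕋³ → E³) (q : ℝ → 𝕋³ → ℝ),
          IsClassicalNSSolutionOn (Set.Ici 0) ν (fun _ => F) v q ∧ (∀ t : ℝ, 0 ≤ t → HasZeroMean (v t)) ∧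
          ∀ T ε : ℝ, 0 ≤ T → 0 < ε → ∀ᶠ n in atTop, ∀ t ∈ Set.Icc 0 T,
            (∫ x, ‖u (s (φ n) + t) x - v t x‖ ^ 2) ≤ ε ∧
              gradNormSq (fun x => u (s (φ n) + t) x - v t x) ≤ ε) →
      ∃ (K : Set Hsp) (φ : ℝ → Hsp → Hsp) (x₀ : Hsp), IsNSPhase ν F K φ ∧ x₀ ∈ K ∧
        ∀ t : ℝ, 0 ≤ t → rep (φ t x₀) =ᵐ[volume] u t :=
  Summit.AnomalousDissipation.AnomalousDissipation.Theorems.ChainRealisation.SeparatrixFluxPinning.stub_phaseOfCompactLimits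

/-- Glue (kernel-checked): **the forward phase above the `H²` rung** (the statement of lead -0's expired stub
`stub_forwardPhaseH2`, hypothesis `hFP2` of the landed conditional glue `Theorems.…Eternalisation.eternalisationZM_of_forwardPhaseH2`)
from B1–B6: all-order bounds (B2∘B1) ⇒ compact limits of shifts (B5∘(B3,B4)) ⇒ phase (B6). -/
theorem forwardPhaseH2_of :
    ∀ (ν : ℝ) (F : 𝕋³ → E³) (u : ℝ → 𝕋³ → E³) (p : ℝ → 𝕋³ → ℝ),
      0 < ν → IsSmooth F → IsDivFree F → HasZeroMean F →
      IsClassicalNSSolutionOn (Set.Ici 0) ν (fun _ => F) u p →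
      (∃ M : ℝ, ∀ t : ℝ, 0 ≤ t → gradNormSq (u t) ≤ M) →
      (∀ t : ℝ, 0 ≤ t → HasZeroMean (u t)) →
      (∃ M₂ : ℝ, ∀ t : ℝ, 1 ≤ t → ∫ x, ‖laplacian (u t) x‖ ^ 2 ≤ M₂) →
      ∃ (K : Set Hsp) (φ : ℝ → Hsp → Hsp) (x₀ : Hsp), IsNSPhase ν F K φ ∧ x₀ ∈ K ∧
        ∀ t : ℝ, 0 ≤ t → rep (φ t x₀) =ᵐ[volume] u t := by
  intro ν F u p hν hF hdiv hmean hsol hM hzm hM2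
  have hall : ∀ k : ℕ, ∃ C : ℝ, ∀ t : ℝ, 0 ≤ t → sobolevEnergy k (u t) ≤ C :=
    stub_sobolevBootstrap stub_convectWordEstimate ν F u p hν hF hsol hzm hM hM2
  have hcomp := stub_compactLimitsOfShifts stub_liftBounds stub_ascoliSmooth ν F u p hν hF hdiv hmean hsol hzm hall
  exact stub_phaseOfCompactLimits ν F u p hν.le hsol hzm hcomp

/-- Glue (kernel-checked): **the forward phase** from the `H²` absorbing bound S4 and the phase construction above
`H²` (E1a) — the statement consumed by the ergodic chain and by the landed conditional glue
`Theorems.…Eternalisation.eternalisationZM_of_forwardPhase`. -/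
theorem forwardPhase_of :
    ∀ (ν : ℝ) (F : 𝕋³ → E³) (u : ℝ → 𝕋³ → E³) (p : ℝ → 𝕋³ → ℝ),
      0 < ν → IsSmooth F → IsDivFree F → HasZeroMean F →
      IsClassicalNSSolutionOn (Set.Ici 0) ν (fun _ => F) u p →
      (∃ M : ℝ, ∀ t : ℝ, 0 ≤ t → gradNormSq (u t) ≤ M) →
      (∀ t : ℝ, 0 ≤ t → HasZeroMean (u t)) →
      ∃ (K : Set Hsp) (φ : ℝ → Hsp → Hsp) (x₀ : Hsp), IsNSPhase ν F K φ ∧ x₀ ∈ K ∧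
        ∀ t : ℝ, 0 ≤ t → rep (φ t x₀) =ᵐ[volume] u t := by
  intro ν F u p hν hF hdiv hmean hsol hM hzm
  refine forwardPhaseH2_of ν F u p hν hF hdiv hmean hsol hM hzm ?_
  obtain ⟨M, hM'⟩ := hM
  exact stub_laplacianSupBound ν M F u p hν hF hsol hM' hzm

/-- Stub E1c (S–M) **PHASE MEANS**: along a phase trajectory represented by classical slices `w t` (`t ≥ 0`), the
trajectory time means of the phase (`energyAvg`, `dissipAvg`, built from the `H`-norm and the spectral enstrophy of
a representative) ARE the Cesàro means entering `meanEnergy` / `meanDissipation` of `w` (the `L²` norm of a class is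
the integral of any representative; `eGradNormSq` depends only on the a.e. class; `timeMean` only sees `t ∈ (0,T]`). -/
theorem stub_phaseMeans :
    ∀ (ν : ℝ) (F : 𝕋³ → E³) (K : Set Hsp) (φ : ℝ → Hsp → Hsp) (x : Hsp) (w : ℝ → 𝕋³ → E³),
      IsNSPhase ν F K φ → x ∈ K → (∀ t : ℝ, 0 ≤ t → IsSmooth (w t)) →
      (∀ t : ℝ, 0 ≤ t → rep (φ t x) =ᵐ[volume] w t) →
      (∀ T : ℝ, 0 ≤ T → energyAvg φ x T = timeMean (fun t => ∫ y, ‖w t y‖ ^ 2) T) ∧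
      (∀ T : ℝ, 0 ≤ T → dissipAvg ν φ x T = timeMean (fun t => ν * (eGradNormSq (w t)).toReal) T) :=
  Summit.AnomalousDissipation.AnomalousDissipation.Theorems.ChainRealisation.SeparatrixFluxPinning.stub_phaseMeans

/-- Stub E2a (M–L) **KRYLOV–BOGOLIUBOV WITH THE LIMSUP**: a trajectory of an NS phase carries an invariant probability
measure on `K` whose ensemble dissipation EQUALS the limsup of the trajectory's dissipation means and whose ensemble
energy is at most the limsup of its energy means (time-average measure for a generalized limit `Λ` chosen, by
Hahn–Banach against the sublinear `limsup`, to realise the limsup on the dissipation means; Riesz–Markov on the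
compact `K` — tree `RieszRepresentation.exists_probabilityMeasure_of_isTightFunctional`; invariance because Cesàro means
of `Ψ ∘ φ_{·+s}` and `Ψ ∘ φ_·` differ by `O(1/T)`; the observables `‖·‖²` and `ν·enstrophyObs` are continuous on the
compact `K`).  Foias–Manley–Rosa–Temam 2001 Ch. IV §1.3, §3.1. -/
theorem stub_invariantMeasureOfTrajectory :
    ∀ (ν : ℝ) (F : 𝕋³ → E³) (K : Set Hsp) (φ : ℝ → Hsp → Hsp) (x₀ : Hsp),
      0 ≤ ν → IsNSPhase ν F K φ → x₀ ∈ K →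
      ∃ μ : Measure Hsp, IsInvariantMeasure K φ μ ∧
        ensembleDissipation ν μ = limsup (dissipAvg ν φ x₀) atTop ∧
        ensembleEnergy μ ≤ limsup (energyAvg φ x₀) atTop :=
  Summit.AnomalousDissipation.AnomalousDissipation.Theorems.ChainRealisation.SeparatrixFluxPinning.stub_invariantMeasureOfTrajectory

/-- Stub E2b (M–L) **GENERIC LOUD POINT**: an invariant probability measure on an NS phase with ensemble dissipation
`≥ ε > 0` and ensemble energy `≤ E` has a point `y ∈ K` with a COMPLETE backward chain in `K` whose forward
trajectory means CONVERGE, to a dissipation `≥ ε/2` and an energy `≤ 16‖F‖₂² max(E,1)²/ε²` (Birkhoff means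
`stub_birkhoffMeans` of the BaireTransfer line, landed; the trajectory-wise power budget `D ≤ ‖F‖₂√En` a.e. from the
energy equality of the classical trajectories — `meanDissipation_eq_longTimeAvgSup_inner`, landed with
`stub_loudOfContrast`; `budget_selection`, landed; invariant measures are carried by `⋂ₙ φₙ(K)`). -/
theorem stub_genericLoudPoint :
    ∀ (ν : ℝ) (F : 𝕋³ → E³) (K : Set Hsp) (φ : ℝ → Hsp → Hsp) (μ : Measure Hsp) (E ε : ℝ),
      0 < ν → IsSmooth F → HasZeroMean F → IsNSPhase ν F K φ → IsInvariantMeasure K φ μ →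
      0 < ε → ε ≤ ensembleDissipation ν μ → ensembleEnergy μ ≤ E →
      ∃ y ∈ K, (∀ n : ℕ, ∃ z ∈ K, φ n z = y) ∧ ∃ d e : ℝ,
        Tendsto (dissipAvg ν φ y) atTop (nhds d) ∧ Tendsto (energyAvg φ y) atTop (nhds e) ∧
        ε / 2 ≤ d ∧ e ≤ 16 * (∫ x, ‖F x‖ ^ 2) * (max E 1) ^ 2 / ε ^ 2 :=
  Summit.AnomalousDissipation.AnomalousDissipation.Theorems.ChainRealisation.SeparatrixFluxPinning.stub_genericLoudPoint

/-- Stub E1b (M–L) **ETERNAL ORBIT**: a point of an NS phase with a complete backward chain in `K` lies on an ETERNAL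
classical solution of the same system (compactness of `K` + continuity of `φ₁` turn the chain into a coherent backward
orbit inside `⋂ₙ φₙ(K)`; the classical trajectories of its points (`IsNSPhase.trajectory`) agree on overlaps by
`Torus.IsClassicalNSSolutionOn.velocity_unique_of_mem` after time translation, and glue — with the pressures
normalised at a base point — to a classical solution on `ℝ × T³`). -/
theorem stub_eternalOrbit :
    ∀ (ν : ℝ) (F : 𝕋³ → E³) (K : Set Hsp) (φ : ℝ → Hsp → Hsp) (y : Hsp),
      0 ≤ ν → IsNSPhase ν F K φ → y ∈ K → (∀ n : ℕ, ∃ z ∈ K, φ n z = y) →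
      ∃ (v : ℝ → 𝕋³ → E³) (q : ℝ → 𝕋³ → ℝ),
        IsClassicalNSSolutionOn Set.univ ν (fun _ => F) v q ∧
        ∀ t : ℝ, 0 ≤ t → rep (φ t y) =ᵐ[volume] v t :=
  Summit.AnomalousDissipation.AnomalousDissipation.Theorems.ChainRealisation.SeparatrixFluxPinning.stub_eternalOrbit

/-- `limsup` of the phase means versus `longTimeAvgSup` of matching Cesàro means. -/
theorem limsup_eq_longTimeAvgSup_of_eq {a : ℝ → ℝ} {g : ℝ → ℝ} (h : ∀ T : ℝ, 0 ≤ T → a T = timeMean g T) :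
    limsup a atTop = longTimeAvgSup g := by
  unfold longTimeAvgSup
  refine limsup_congr ?_
  filter_upwards [eventually_ge_atTop (0 : ℝ)] with T hT using h T hT

/-- **Glue (kernel-checked): the four phase stubs give eternalisation in the mean-zero class.** -/
theorem eternalisationZM_of {ν : ℝ} {f : 𝕋³ → E³} (hν : 0 < ν) (hf : IsSmooth f) (hdiv : IsDivFree f)
    (hmean : HasZeroMean f) : EternalisationAtZM ν f := by
  intro u p E ε hsol hM hzm hE hε hεD
  -- E1a: the forward phase from time 1
  obtain ⟨K, φ, x₀, hK, hx₀, hrep⟩ := forwardPhase_of ν f u p hν hf hdiv hmean hsol hM hzm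
  -- E1c: its trajectory means are the Cesàro means of the solution
  have hsm : ∀ t : ℝ, 0 ≤ t → IsSmooth (u t) := fun t ht =>
    hsol.smooth_velocity.isSmooth_slice (Set.mem_Ici.2 ht)
  obtain ⟨hEavg, hDavg⟩ := stub_phaseMeans ν f K φ x₀ u hK hx₀ hsm hrep
  have hlimE : limsup (energyAvg φ x₀) atTop = meanEnergy u := by
    rw [meanEnergy_eq_longTimeAvgSup]
    exact limsup_eq_longTimeAvgSup_of_eq hEavg
  have hlimD : limsup (dissipAvg ν φ x₀) atTop = meanDissipation ν u := by
    unfold meanDissipation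
    exact limsup_eq_longTimeAvgSup_of_eq hDavg
  -- E2a: an invariant measure realising the limsup of the dissipation means
  obtain ⟨μ, hμ, hμD, hμE⟩ := stub_invariantMeasureOfTrajectory ν f K φ x₀ hν.le hK hx₀
  have hεμ : ε ≤ ensembleDissipation ν μ := by rw [hμD, hlimD]; exact hεD
  have hEμ : ensembleEnergy μ ≤ E := by rw [hlimE] at hμE; exact hμE.trans hE
  -- E2b: a generic loud point with a complete backward chain
  obtain ⟨y, hyK, hchain, d, e, hd, he, hεd, heE⟩ :=
    stub_genericLoudPoint ν f K φ μ E ε hν hf hmean hK hμ hε hεμ hEμ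
  -- E1b: the eternal classical solution through it, and its means (E1c again)
  obtain ⟨v, q, hv, hvrep⟩ := stub_eternalOrbit ν f K φ y hν.le hK hyK hchain
  have hsmv : ∀ t : ℝ, 0 ≤ t → IsSmooth (v t) := fun t _ =>
    hv.smooth_velocity.isSmooth_slice (Set.mem_univ t)
  obtain ⟨hEavg', hDavg'⟩ := stub_phaseMeans ν f K φ y v hK hyK hsmv hvrep
  have hmeanEv : meanEnergy v = e := by
    rw [meanEnergy_eq_longTimeAvgSup, ← limsup_eq_longTimeAvgSup_of_eq hEavg']
    exact he.limsup_eq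
  have hmeanDv : meanDissipation ν v = d := by
    unfold meanDissipation
    rw [← limsup_eq_longTimeAvgSup_of_eq hDavg']
    exact hd.limsup_eq
  exact ⟨v, q, hv, hmeanEv ▸ heE, hmeanDv ▸ hεd⟩

/-! ## §3 The residual: the cellular mean-contrast family (card Transfer C⁺) and the budget step -/

/-- **CONTRAST FAMILY** (the card's `CellularMeanContrast`, T³-typed; the line's ONE conjecture-grade residual).
There are a smooth planar solenoidal mean-free `g`, a smooth mean-free axial pattern `h`, an amplitude `μ > 0`, a
contrast floor `a₀ > 0` and an energy ceiling `E` such that the arena force `f = twoHalf g (μ h)` carries, along some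
`ν_j → 0`, FORWARD classical trajectories on `[0, ∞) × T³` that are regular (`j`-dependent enstrophy bound on `t ≥ 1`),
MEAN-ZERO (conserved: `f` is mean-free), of limsup-mean energy `≤ E`, on which (i) the planar force does
non-negative mean work (`0 ≤ liminf_T T⁻¹∫₀ᵀ ∫ ⟪g(πx), u_h⟫`) and (ii) the AXIAL CONTRAST has a `j`-uniform floor
(`a₀ ≤ limsup_T T⁻¹∫₀ᵀ ∫ h(πx) u₂`).  By `stub_pinnedSeparatrixFlux` the eddy flux of axial momentum through every mean
separatrix is already `μ·(enclosed ∫h)` whatever the regime does, so (ii) fails only through contrast-free transport.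
Its proof for ANY arena is the zeroth-law content of the crux; its refutation for a GIVEN arena is a laminarisation /
contrast-free-transport theorem. -/
def ContrastFamily : Prop :=
  ∃ (g : 𝕋² → E²) (h : 𝕋² → ℝ) (μ a₀ E : ℝ),
    IsSmooth g ∧ IsDivFree g ∧ HasZeroMean g ∧ IsSmooth h ∧ HasZeroMean h ∧ 0 < μ ∧ 0 < a₀ ∧
    ∃ (ν : ℕ → ℝ) (u : ℕ → ℝ → 𝕋³ → E³) (p : ℕ → ℝ → 𝕋³ → ℝ),
      (∀ j, 0 < ν j) ∧ Tendsto ν atTop (nhds 0) ∧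
      (∀ j, IsClassicalNSSolutionOn (Set.Ici 0) (ν j) (fun _ => arenaForce g h μ) (u j) (p j)) ∧
      (∀ j, ∃ M : ℝ, ∀ t : ℝ, 0 ≤ t → gradNormSq (u j t) ≤ M) ∧
      (∀ j t, 0 ≤ t → HasZeroMean (u j t)) ∧
      (∀ j, meanEnergy (u j) ≤ E) ∧
      (∀ j, 0 ≤ longTimeAvgInf (fun t => ∫ x, ⟪g (planarProj x), planarProjE (u j t x)⟫_ℝ)) ∧
      (∀ j, a₀ ≤ longTimeAvgSup (fun t => ∫ x, h (planarProj x) * u j t x 2))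

/-- Glue (kernel-checked): the residual supplies the hypothesis package of the budget step — the pointwise forward energy
bound asked there is AUTOMATIC for mean-zero slices with bounded enstrophy (Poincaré `4π²∫‖u‖² ≤ ‖∇u‖₂²`,
`four_pi_sq_mul_integral_norm_sq_le_gradNormSq`). -/
theorem contrastPackage_of_contrastFamily (hCF : ContrastFamily) :
    ∃ (g : 𝕋² → E²) (h : 𝕋² → ℝ) (μ a₀ E : ℝ),
      IsSmooth g ∧ IsDivFree g ∧ HasZeroMean g ∧ IsSmooth h ∧ HasZeroMean h ∧ 0 < μ ∧ 0 < a₀ ∧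
      ∃ (ν : ℕ → ℝ) (u : ℕ → ℝ → 𝕋³ → E³) (p : ℕ → ℝ → 𝕋³ → ℝ),
        (∀ j, 0 < ν j) ∧ Tendsto ν atTop (nhds 0) ∧
        (∀ j, IsClassicalNSSolutionOn (Set.Ici 0) (ν j) (fun _ => twoHalf g (μ • h)) (u j) (p j)) ∧
        (∀ j, ∃ M : ℝ, ∀ t : ℝ, 0 ≤ t → gradNormSq (u j t) ≤ M) ∧
        (∀ j t, 0 ≤ t → HasZeroMean (u j t)) ∧
        (∀ j, ∃ C : ℝ, ∀ t : ℝ, 0 ≤ t → ∫ x, ‖u j t x‖ ^ 2 ≤ C) ∧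
        (∀ j, meanEnergy (u j) ≤ E) ∧
        (∀ j, 0 ≤ longTimeAvgInf (fun t => ∫ x, ⟪g (planarProj x), planarProjE (u j t x)⟫_ℝ)) ∧
        (∀ j, a₀ ≤ longTimeAvgSup (fun t => ∫ x, h (planarProj x) * u j t x 2)) := by
  obtain ⟨g, h, μ, a₀, E, hg, hgdiv, hg0, hh, hh0, hμ, ha₀, ν, u, p, hν, hν0, hsol, hM, hzm, hE, hIg, hIh⟩ := hCF
  refine ⟨g, h, μ, a₀, E, hg, hgdiv, hg0, hh, hh0, hμ, ha₀, ν, u, p, hν, hν0, hsol, hM, hzm, ?_, hE, hIg, hIh⟩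
  intro j
  obtain ⟨M, hMj⟩ := hM j
  refine ⟨M / (4 * Real.pi ^ 2), fun t ht => ?_⟩
  have hsm : IsSmooth (u j t) := (hsol j).smooth_velocity.isSmooth_slice (Set.mem_Ici.2 ht)
  have hP := four_pi_sq_mul_integral_norm_sq_le_gradNormSq hsm (hzm j t ht)
  have hπ : 0 < 4 * Real.pi ^ 2 := by positivity
  rw [le_div_iff₀ hπ]
  calc (∫ x, ‖u j t x‖ ^ 2) * (4 * Real.pi ^ 2) = 4 * Real.pi ^ 2 * ∫ x, ‖u j t x‖ ^ 2 := by ring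
    _ ≤ gradNormSq (u j t) := hP
    _ ≤ M := hMj t ht

/-- Stub (M–L, provable now; LANDED p88369) **the budget step** without the mean-zero clause (wave 1 signature, kept
verbatim: energy EQUALITY on `[0,T]` + the forward energy bound give `meanDissipation ν u = limsup_T T⁻¹∫₀ᵀ ∫⟪f, u⟫`;
the injection of `twoHalf g (μ • h)` splits as `⟪g(πx), πE u⟫ + μ h(πx) u₂`; with (i)–(ii) loud with `ε = μ a₀`). -/
theorem stub_loudOfContrast :
    (∃ (g : 𝕋² → E²) (h : 𝕋² → ℝ) (μ a₀ E : ℝ),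
      IsSmooth g ∧ IsDivFree g ∧ HasZeroMean g ∧ IsSmooth h ∧ HasZeroMean h ∧ 0 < μ ∧ 0 < a₀ ∧
      ∃ (ν : ℕ → ℝ) (u : ℕ → ℝ → 𝕋³ → E³) (p : ℕ → ℝ → 𝕋³ → ℝ),
        (∀ j, 0 < ν j) ∧ Tendsto ν atTop (nhds 0) ∧
        (∀ j, IsClassicalNSSolutionOn (Set.Ici 0) (ν j) (fun _ => twoHalf g (μ • h)) (u j) (p j)) ∧
        (∀ j, ∃ M : ℝ, ∀ t : ℝ, 1 ≤ t → gradNormSq (u j t) ≤ M) ∧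
        (∀ j, ∃ C : ℝ, ∀ t : ℝ, 0 ≤ t → ∫ x, ‖u j t x‖ ^ 2 ≤ C) ∧
        (∀ j, meanEnergy (u j) ≤ E) ∧
        (∀ j, 0 ≤ longTimeAvgInf (fun t => ∫ x, ⟪g (planarProj x), planarProjE (u j t x)⟫_ℝ)) ∧
        (∀ j, a₀ ≤ longTimeAvgSup (fun t => ∫ x, h (planarProj x) * u j t x 2))) →
    ∃ f : 𝕋³ → E³, IsSmooth f ∧ IsDivFree f ∧ HasZeroMean f ∧
      ∃ (ν : ℕ → ℝ) (u : ℕ → ℝ → 𝕋³ → E³) (p : ℕ → ℝ → 𝕋³ → ℝ),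
        (∀ j, 0 < ν j) ∧ Tendsto ν atTop (nhds 0) ∧
        (∀ j, IsClassicalNSSolutionOn (Set.Ici 0) (ν j) (fun _ => f) (u j) (p j)) ∧
        (∀ j, ∃ M : ℝ, ∀ t : ℝ, 1 ≤ t → gradNormSq (u j t) ≤ M) ∧
        (∃ E : ℝ, ∀ j, meanEnergy (u j) ≤ E) ∧
        ∃ ε : ℝ, 0 < ε ∧ ∀ j, ε ≤ meanDissipation (ν j) (u j) :=
  Summit.AnomalousDissipation.AnomalousDissipation.Theorems.ChainRealisation.SeparatrixFluxPinning.stub_loudOfContrast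

/-- Stub (S given the landed budget step) **the budget step in the mean-zero class**: the same statement with the
mean-zero clause carried from the hypothesis package to the conclusion (same proof: the family is kept, `f :=
twoHalf g (μ • h)`, `ε := μ a₀`; reuse `meanDissipation_eq_longTimeAvgSup_inner`, `mul_le_longTimeAvgSup_inner_twoHalf`,
`hasZeroMean_twoHalf_smul` of the landed file). -/
theorem stub_loudOfContrastZM :
    (∃ (g : 𝕋² → E²) (h : 𝕋² → ℝ) (μ a₀ E : ℝ),
      IsSmooth g ∧ IsDivFree g ∧ HasZeroMean g ∧ IsSmooth h ∧ HasZeroMean h ∧ 0 < μ ∧ 0 < a₀ ∧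
      ∃ (ν : ℕ → ℝ) (u : ℕ → ℝ → 𝕋³ → E³) (p : ℕ → ℝ → 𝕋³ → ℝ),
        (∀ j, 0 < ν j) ∧ Tendsto ν atTop (nhds 0) ∧
        (∀ j, IsClassicalNSSolutionOn (Set.Ici 0) (ν j) (fun _ => twoHalf g (μ • h)) (u j) (p j)) ∧
        (∀ j, ∃ M : ℝ, ∀ t : ℝ, 0 ≤ t → gradNormSq (u j t) ≤ M) ∧
        (∀ j t, 0 ≤ t → HasZeroMean (u j t)) ∧
        (∀ j, ∃ C : ℝ, ∀ t : ℝ, 0 ≤ t → ∫ x, ‖u j t x‖ ^ 2 ≤ C) ∧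
        (∀ j, meanEnergy (u j) ≤ E) ∧
        (∀ j, 0 ≤ longTimeAvgInf (fun t => ∫ x, ⟪g (planarProj x), planarProjE (u j t x)⟫_ℝ)) ∧
        (∀ j, a₀ ≤ longTimeAvgSup (fun t => ∫ x, h (planarProj x) * u j t x 2))) →
    ∃ f : 𝕋³ → E³, IsSmooth f ∧ IsDivFree f ∧ HasZeroMean f ∧
      ∃ (ν : ℕ → ℝ) (u : ℕ → ℝ → 𝕋³ → E³) (p : ℕ → ℝ → 𝕋³ → ℝ),
        (∀ j, 0 < ν j) ∧ Tendsto ν atTop (nhds 0) ∧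
        (∀ j, IsClassicalNSSolutionOn (Set.Ici 0) (ν j) (fun _ => f) (u j) (p j)) ∧
        (∀ j, ∃ M : ℝ, ∀ t : ℝ, 0 ≤ t → gradNormSq (u j t) ≤ M) ∧
        (∀ j t, 0 ≤ t → HasZeroMean (u j t)) ∧
        (∃ E : ℝ, ∀ j, meanEnergy (u j) ≤ E) ∧
        ∃ ε : ℝ, 0 < ε ∧ ∀ j, ε ≤ meanDissipation (ν j) (u j) :=
  Summit.AnomalousDissipation.AnomalousDissipation.Theorems.ChainRealisation.SeparatrixFluxPinning.stub_loudOfContrastZM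

/-- Stub (RESIDUAL, conjecture-grade; held by the lead): the contrast family exists. -/
theorem stub_contrastFamily : ContrastFamily := by
  sorry

/-- Stub (glue, S) **the line as ONE conditional theorem**: `ChainThesis` (hence the crux) from the phase construction above the `H²`
rung (`stub_forwardPhaseH2`'s statement) and the residual (`ContrastFamily` unfolded).  PROVED in the landed conditional
glue file `Theorems/MarginalStabilityChainChainRealisationEternalisation.lean` (p93720; registered as a stub only so that file could
ride `--supports`). -/
theorem stub_lineConditional :
    (∀ (ν : ℝ) (F : 𝕋³ → E³) (u : ℝ → 𝕋³ → E³) (p : ℝ → 𝕋³ → ℝ),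
      0 < ν → IsSmooth F → IsDivFree F → HasZeroMean F →
      IsClassicalNSSolutionOn (Set.Ici 0) ν (fun _ => F) u p →
      (∃ M : ℝ, ∀ t : ℝ, 0 ≤ t → gradNormSq (u t) ≤ M) →
      (∀ t : ℝ, 0 ≤ t → HasZeroMean (u t)) →
      (∃ M₂ : ℝ, ∀ t : ℝ, 1 ≤ t → ∫ x, ‖laplacian (u t) x‖ ^ 2 ≤ M₂) →
      ∃ (K : Set Hsp) (φ : ℝ → Hsp → Hsp) (x₀ : Hsp), IsNSPhase ν F K φ ∧ x₀ ∈ K ∧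
        ∀ t : ℝ, 0 ≤ t → rep (φ t x₀) =ᵐ[volume] u t) →
    (∃ (g : 𝕋² → E²) (h : 𝕋² → ℝ) (μ a₀ E : ℝ),
      IsSmooth g ∧ IsDivFree g ∧ HasZeroMean g ∧ IsSmooth h ∧ HasZeroMean h ∧ 0 < μ ∧ 0 < a₀ ∧
      ∃ (ν : ℕ → ℝ) (u : ℕ → ℝ → 𝕋³ → E³) (p : ℕ → ℝ → 𝕋³ → ℝ),
        (∀ j, 0 < ν j) ∧ Tendsto ν atTop (nhds 0) ∧
        (∀ j, IsClassicalNSSolutionOn (Set.Ici 0) (ν j) (fun _ => twoHalf g (μ • h)) (u j) (p j)) ∧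
        (∀ j, ∃ M : ℝ, ∀ t : ℝ, 0 ≤ t → gradNormSq (u j t) ≤ M) ∧
        (∀ j t, 0 ≤ t → HasZeroMean (u j t)) ∧
        (∀ j, meanEnergy (u j) ≤ E) ∧
        (∀ j, 0 ≤ longTimeAvgInf (fun t => ∫ x, ⟪g (planarProj x), planarProjE (u j t x)⟫_ℝ)) ∧
        (∀ j, a₀ ≤ longTimeAvgSup (fun t => ∫ x, h (planarProj x) * u j t x 2))) →
    ChainThesis :=
  Summit.AnomalousDissipation.AnomalousDissipation.Theorems.ChainRealisation.SeparatrixFluxPinning.stub_lineConditional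

/-! ## §4 Composition: the crux BY NAME -/

/-- **The skeleton**: residual ⇒ forward loud mean-zero family for one force (budget step) ⇒ eternal loud bounded
classical solutions at every `ν_j` (phase ⇒ invariant measure ⇒ generic loud point ⇒ eternal orbit) ⇒ `ChainThesis`
⇒ `ChainRealisation`. -/
theorem ChainRealisation_of : ChainRealisation := by
  refine chainRealisation_of_chainThesis ?_
  obtain ⟨f, hf, hdiv, hmean, hC⟩ := stub_loudOfContrastZM (contrastPackage_of_contrastFamily stub_contrastFamily)
  exact chainThesis_of_forwardFamilyZM hf hdiv hmean (fun ν hν => eternalisationZM_of hν hf hdiv hmean) hC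

end Summit.AnomalousDissipation.AnomalousDissipation.Cruxes.ChainRealisation.SeparatrixFluxPinning

end
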